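import Mathlib.MeasureTheory.Integral.IntervalIntegral.Basic
import Mathlib.MeasureTheory.Integral.IntervalIntegral.IntegrationByParts
import Mathlib.Analysis.SpecialFunctions.Integrals.Basic
import Mathlib.Tactic
import HarnessLib

/-!
# The denominator rates `τ♭(b)`, `τ♯(e)`, `τ(b;e)` of the fine holonomy bound (CDT Def. 51, Thm. 52)

Calegari–Dimitrov–Tang, arXiv:2408.15403, §6 (pp. 45–46). Theorem 52 ("main: elementary form")
bounds the number `m` of `ℚ(x)`-linearly independent functions of denominator types
`n^{eᵢ} [1,…,b_{i,1} n] ⋯ [1,…,b_{i,r} n]` by a quotient whose denominator is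
`log|φ_l'(0)| − τ(b;e)` with `τ(b;e) = τ♭(b) + τ♯(e)`,
`τ♭(b) = (1/m²) Σ_{i=1}^m (2i − 1) σᵢ` (`σᵢ` the `i`-th row sum of `b`, eq. (6.3)),
`τ♯(e) = (2/m²) min_{ξ ∈ [0,m]} { ξ Σᵢ eᵢ + (maxᵢ eᵢ) I_ξ^m(ξ) }` (eq. (6.4)) and the function
`I_u^v(w)` of Definition 51. In the proof of Theorem 1 (§13, eqs. (tauflat A), (tausharp A),
(taufine), p. 106) these are evaluated on the `14 × 2` array `b` and the integrations vector `e`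
of the `Y₀(2)` data: `τ♭(b) = 191/49`, `τ♯(e) = 27/80` (minimiser `ξ ∈ [2, 13/6]`),
`τ(b;e) = 16603/3920 = 4.235459…`.

This file defines `I_u^v(w)`, `τ♭`, `τ♯`, `τ` exactly as printed and proves, for the §13 data,
`τ♭(b) = 191/49` and the upper bounds `τ♯(e) ≤ 27/80`, `τ(b;e) ≤ 16603/3920` by evaluating at
`ξ = 2`: `I_2^{14}(2) = 1191/60 + 49/40 = 843/40` (the minimum over `ξ` is read off a graph in the
source; only the upper bound enters the proof of Theorem 1, through the denominator
`log|φ'(0)| − τ(b;e)` of the holonomy quotient).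

* `HolonomyBound.integratedLcm u v w` — `I_u^v(w)` (Definition 51).
* `HolonomyBound.tauFlat`, `HolonomyBound.tauSharp`, `HolonomyBound.tau` — eqs. (6.3)–(6.5).
* `HolonomyBound.bA`, `HolonomyBound.eA` — the §13 data; `tauFlat_bA : τ♭(b) = 191/49`,
  `integratedLcm_two_fourteen_two : I_2^{14}(2) = 843/40`, `tauSharp_eA_le : τ♯(e) ≤ 27/80`,
  `tau_A_le : τ(b;e) ≤ 16603/3920`.
* `HolonomyBound.tauFlat_eq_of_columnShape` — the closed form
  `τ♭(b) = Σ_j b_j − (1/m²) Σ_j u_j² b_j ∈ [0, σ_m]` for column-shaped arrays asserted in the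
  statements of Theorems 9 and 52; `HolonomyBound.sum_lcmCap_exponent_eq` — the exact form of the
  `(lcm cap)` exponent computation of §6.6.2, `= α τ♭(b) + (D/2) Σᵢ σᵢ`.

No named facts.

## References

* [CalegariDimitrovTang2024] arXiv:2408.15403, §6 Definition 51, Theorem 52 eqs. (6.3)–(6.5)
  (p. 45); §13 eqs. (tauflat A)–(taufine) (p. 106).
-/

noncomputable section

open MeasureTheory Set intervalIntegral

namespace Literature.NumberTheory.Transcendental

namespace HolonomyBound

/-! ### Definition 51 and the rates of Theorem 52 -/

/-- CDT Definition 51: for `0 ≤ max{u,1} ≤ v` and `w ≤ v`,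
`I_u^v(w) = ∫_{min{u,1}}^1 max{t−w,0} dt + ∫_{max{u,1}}^v Σ_{h=1}^{⌊(t−1)/max(1,w)⌋} 1/h dt
  + ∫_{max{u,1}}^v max{ t/⌊(t+max(0,w−1))/max(1,w)⌋ − w, 0 } dt`.
[cite: CalegariDimitrovTang2024, §6 Definition 51 (p. 45)] -/
def integratedLcm (u v w : ℝ) : ℝ :=
  (∫ t in min u 1..1, max (t - w) 0) +
  (∫ t in max u 1..v, ∑ h ∈ Finset.Icc 1 ⌊(t - 1) / max 1 w⌋₊, (1 : ℝ) / h) +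
  ∫ t in max u 1..v, max (t / ⌊(t + max 0 (w - 1)) / max 1 w⌋₊ - w) 0

variable {m r : ℕ}

/-- The `i`-th row sum `σᵢ = b_{i,1} + ⋯ + b_{i,r}` of a denominator-type array.
[cite: CalegariDimitrovTang2024, §6 Theorem 52 (p. 45)] -/
def rowSum (b : Fin m → Fin r → ℝ) (i : Fin m) : ℝ := ∑ j, b i j

/-- CDT eq. (6.3): `τ♭(b) = (1/m²) Σ_{i=1}^m (2i − 1) σᵢ` (rows indexed by `Fin m`, so the weight
of row `i` is `2i + 1`). [cite: CalegariDimitrovTang2024, §6 Theorem 52 eq. (6.3) (p. 45)] -/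
def tauFlat (b : Fin m → Fin r → ℝ) : ℝ :=
  (1 / (m : ℝ) ^ 2) * ∑ i : Fin m, (2 * (i : ℝ) + 1) * rowSum b i

/-- CDT eq. (6.4): `τ♯(e) = (2/m²) min_{ξ ∈ [0,m]} { ξ Σᵢ eᵢ + (maxᵢ eᵢ) I_ξ^m(ξ) }` (as an
infimum over `ξ ∈ [0, m]`). [cite: CalegariDimitrovTang2024, §6 Theorem 52 eq. (6.4) (p. 45)] -/
def tauSharp (m : ℕ) (e : Fin m → ℕ) : ℝ :=
  (2 / (m : ℝ) ^ 2) * sInf ((fun ξ : ℝ => ξ * ∑ i, (e i : ℝ) +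
    ((Finset.univ.sup e : ℕ) : ℝ) * integratedLcm ξ m ξ) '' Icc (0 : ℝ) m)

/-- CDT eq. (6.5): `τ(b;e) = τ♭(b) + τ♯(e)`.
[cite: CalegariDimitrovTang2024, §6 Theorem 52 eq. (6.5) (p. 45)] -/
def tau (b : Fin m → Fin r → ℝ) (e : Fin m → ℕ) : ℝ := tauFlat b + tauSharp m e

/-! ### The data of §13 -/

/-- The `14 × 2` denominator-type array of §13, eq. (typesA):
columns `(0,2,2,…,2)ᵗ` and `(0,0,0,2,…,2)ᵗ`. [cite: CalegariDimitrovTang2024, §13 eq. (typesA) (p. 106)] -/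
def bA : Fin 14 → Fin 2 → ℝ := fun i j =>
  if j = 0 then (if i = 0 then 0 else 2) else (if (i : ℕ) ≤ 2 then 0 else 2)

/-- The integrations vector `e = (0,0,1; 0,0,0,0,0,0; 1,1,1,1,1)` of §13.
[cite: CalegariDimitrovTang2024, §13 (p. 106)] -/
def eA : Fin 14 → ℕ := ![0, 0, 1, 0, 0, 0, 0, 0, 0, 1, 1, 1, 1, 1]

/-- `τ♭(b) = (1·0 + (3+5)·2 + (7+9+⋯+27)·4)/14² = 191/49` (CDT eq. (tauflat A)).
[cite: CalegariDimitrovTang2024, §13 eq. (tauflat A) (p. 106)] -/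
theorem tauFlat_bA : tauFlat bA = 191 / 49 := by
  simp only [tauFlat, rowSum, bA, Fin.sum_univ_succ, Fin.sum_univ_zero, Fin.isValue]
  norm_num [Fin.ext_iff]

/-- `Σᵢ eᵢ = 6` for the §13 integrations vector. [cite: CalegariDimitrovTang2024, §13 eq. (tausharp A)] -/
theorem sum_eA : ∑ i, (eA i : ℝ) = 6 := by
  simp [eA, Fin.sum_univ_succ]
  norm_num

/-- `maxᵢ eᵢ = 1` for the §13 integrations vector. [cite: CalegariDimitrovTang2024, §13 eq. (tausharp A)] -/
theorem sup_eA : Finset.univ.sup eA = 1 := by decide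

/-! ### The evaluation `I_2^{14}(2) = 843/40` -/

/-- Transfer of integrability and of the integral along an equality on the open interval.
[folklore] -/
theorem integral_eq_of_eqOn_Ioo {f g : ℝ → ℝ} {a b : ℝ} (hab : a ≤ b)
    (hg : IntervalIntegrable g volume a b) (h : EqOn f g (Ioo a b)) :
    IntervalIntegrable f volume a b ∧ ∫ t in a..b, f t = ∫ t in a..b, g t :=
  ⟨hg.congr_uIoo (by rw [uIoo_of_le hab]; exact h.symm), integral_congr_Ioo_of_le hab h⟩

/-- The harmonic-sum integrand of `I_u^v(2)`: `t ↦ Σ_{h=1}^{⌊(t−1)/2⌋} 1/h`.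
[cite: CalegariDimitrovTang2024, §6 Definition 51 (p. 45), second integral with `w = 2`] -/
def harmIntegrand (t : ℝ) : ℝ := ∑ h ∈ Finset.Icc 1 ⌊(t - 1) / 2⌋₊, (1 : ℝ) / h

/-- The excess integrand of `I_u^v(2)`: `t ↦ max{t/⌊(t+1)/2⌋ − 2, 0}`.
[cite: CalegariDimitrovTang2024, §6 Definition 51 (p. 45), third integral with `w = 2`] -/
def excessIntegrand (t : ℝ) : ℝ := max (t / ⌊(t + 1) / 2⌋₊ - 2) 0

/-- On `[2q+1, 2q+3)` the harmonic-sum integrand is the constant `Σ_{h=1}^q 1/h`; integral over a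
subinterval `[a,b]`. [folklore] -/
theorem harmIntegrand_piece (q : ℕ) {a b : ℝ} (ha : 2 * q + 1 ≤ a) (hab : a ≤ b)
    (hb : b ≤ 2 * q + 3) :
    IntervalIntegrable harmIntegrand volume a b ∧
      ∫ t in a..b, harmIntegrand t = (b - a) * ∑ h ∈ Finset.Icc 1 q, (1 : ℝ) / h := by
  have h := integral_eq_of_eqOn_Ioo hab (f := harmIntegrand)
    (g := fun _ => ∑ h ∈ Finset.Icc 1 q, (1 : ℝ) / h) intervalIntegrable_const (fun t ht => by
      have hfl : ⌊(t - 1) / 2⌋₊ = q := by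
        rw [Nat.floor_eq_iff (by linarith [ht.1])]
        constructor <;> linarith [ht.1, ht.2]
      simp only [harmIntegrand, hfl])
  refine ⟨h.1, ?_⟩
  rw [h.2, intervalIntegral.integral_const, smul_eq_mul]

/-- On `[2n−1, 2n]` (`n ≥ 1`) the excess integrand vanishes. [folklore] -/
theorem excessIntegrand_piece_zero (n : ℕ) (hn : 1 ≤ n) {a b : ℝ} (ha : 2 * n - 1 ≤ a)
    (hab : a ≤ b) (hb : b ≤ 2 * n) :
    IntervalIntegrable excessIntegrand volume a b ∧ ∫ t in a..b, excessIntegrand t = 0 := by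
  have hnR : (1 : ℝ) ≤ n := by exact_mod_cast hn
  have h := integral_eq_of_eqOn_Ioo hab (f := excessIntegrand) (g := fun _ => (0 : ℝ))
    intervalIntegrable_const (fun t ht => by
      have hfl : ⌊(t + 1) / 2⌋₊ = n := by
        rw [Nat.floor_eq_iff (by linarith [ht.1])]
        constructor <;> linarith [ht.1, ht.2]
      simp only [excessIntegrand, hfl]
      refine max_eq_right ?_
      rw [sub_nonpos, div_le_iff₀ (by linarith)]
      linarith [ht.2])
  refine ⟨h.1, ?_⟩
  rw [h.2, intervalIntegral.integral_const, smul_zero]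

/-- On `[2n, 2n+1]` (`n ≥ 1`) the excess integrand is `t/n − 2`; integral `(b²−a²)/(2n) − 2(b−a)`.
[folklore] -/
theorem excessIntegrand_piece_lin (n : ℕ) (hn : 1 ≤ n) {a b : ℝ} (ha : 2 * n ≤ a)
    (hab : a ≤ b) (hb : b ≤ 2 * n + 1) :
    IntervalIntegrable excessIntegrand volume a b ∧
      ∫ t in a..b, excessIntegrand t = (b ^ 2 - a ^ 2) / (2 * n) - 2 * (b - a) := by
  have hnR : (1 : ℝ) ≤ n := by exact_mod_cast hn
  have hg : IntervalIntegrable (fun t : ℝ => t / n - 2) volume a b :=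
    ((continuous_id.div_const _).sub continuous_const).intervalIntegrable _ _
  have h := integral_eq_of_eqOn_Ioo hab (f := excessIntegrand) hg (fun t ht => by
      have hfl : ⌊(t + 1) / 2⌋₊ = n := by
        rw [Nat.floor_eq_iff (by linarith [ht.1])]
        constructor <;> linarith [ht.1, ht.2]
      simp only [excessIntegrand, hfl]
      refine max_eq_left ?_
      rw [sub_nonneg, le_div_iff₀ (by linarith)]
      linarith [ht.1])
  refine ⟨h.1, ?_⟩
  rw [h.2]
  have hf : IntervalIntegrable (fun t : ℝ => t / n) volume a b :=
    (continuous_id.div_const _).intervalIntegrable _ _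
  have h1 : ∫ t in a..b, (t / n - 2) = (∫ t in a..b, t / n) - ∫ _ in a..b, (2 : ℝ) :=
    intervalIntegral.integral_sub hf intervalIntegrable_const
  have h2 : ∫ t in a..b, t / (n : ℝ) = (∫ t in a..b, t) / n :=
    intervalIntegral.integral_div (n : ℝ) (fun t : ℝ => t)
  rw [h1, h2, integral_id, intervalIntegral.integral_const, smul_eq_mul]
  field_simp

/-- `∫_2^{14} Σ_{h=1}^{⌊(t−1)/2⌋} 1/h dt = 1191/60`. [folklore] -/
theorem integral_harmIntegrand : ∫ t in (2 : ℝ)..14, harmIntegrand t = 1191 / 60 := by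
  have p0 := harmIntegrand_piece 0 (a := 2) (b := 3) (by norm_num) (by norm_num) (by norm_num)
  have p1 := harmIntegrand_piece 1 (a := 3) (b := 5) (by norm_num) (by norm_num) (by norm_num)
  have p2 := harmIntegrand_piece 2 (a := 5) (b := 7) (by norm_num) (by norm_num) (by norm_num)
  have p3 := harmIntegrand_piece 3 (a := 7) (b := 9) (by norm_num) (by norm_num) (by norm_num)
  have p4 := harmIntegrand_piece 4 (a := 9) (b := 11) (by norm_num) (by norm_num) (by norm_num)
  have p5 := harmIntegrand_piece 5 (a := 11) (b := 13) (by norm_num) (by norm_num) (by norm_num)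
  have p6 := harmIntegrand_piece 6 (a := 13) (b := 14) (by norm_num) (by norm_num) (by norm_num)
  rw [← integral_add_adjacent_intervals p0.1 (p1.1.trans (p2.1.trans (p3.1.trans (p4.1.trans
      (p5.1.trans p6.1))))),
    ← integral_add_adjacent_intervals p1.1 (p2.1.trans (p3.1.trans (p4.1.trans (p5.1.trans p6.1)))),
    ← integral_add_adjacent_intervals p2.1 (p3.1.trans (p4.1.trans (p5.1.trans p6.1))),
    ← integral_add_adjacent_intervals p3.1 (p4.1.trans (p5.1.trans p6.1)),
    ← integral_add_adjacent_intervals p4.1 (p5.1.trans p6.1),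
    ← integral_add_adjacent_intervals p5.1 p6.1,
    p0.2, p1.2, p2.2, p3.2, p4.2, p5.2, p6.2]
  norm_num [Finset.sum_Icc_succ_top]

/-- `∫_2^{14} max{t/⌊(t+1)/2⌋ − 2, 0} dt = 49/40`. [folklore] -/
theorem integral_excessIntegrand : ∫ t in (2 : ℝ)..14, excessIntegrand t = 49 / 40 := by
  have q1 := excessIntegrand_piece_lin 1 le_rfl (a := 2) (b := 3) (by norm_num) (by norm_num)
    (by norm_num)
  have z2 := excessIntegrand_piece_zero 2 (by norm_num) (a := 3) (b := 4) (by norm_num)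
    (by norm_num) (by norm_num)
  have q2 := excessIntegrand_piece_lin 2 (by norm_num) (a := 4) (b := 5) (by norm_num)
    (by norm_num) (by norm_num)
  have z3 := excessIntegrand_piece_zero 3 (by norm_num) (a := 5) (b := 6) (by norm_num)
    (by norm_num) (by norm_num)
  have q3 := excessIntegrand_piece_lin 3 (by norm_num) (a := 6) (b := 7) (by norm_num)
    (by norm_num) (by norm_num)
  have z4 := excessIntegrand_piece_zero 4 (by norm_num) (a := 7) (b := 8) (by norm_num)
    (by norm_num) (by norm_num)
  have q4 := excessIntegrand_piece_lin 4 (by norm_num) (a := 8) (b := 9) (by norm_num)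
    (by norm_num) (by norm_num)
  have z5 := excessIntegrand_piece_zero 5 (by norm_num) (a := 9) (b := 10) (by norm_num)
    (by norm_num) (by norm_num)
  have q5 := excessIntegrand_piece_lin 5 (by norm_num) (a := 10) (b := 11) (by norm_num)
    (by norm_num) (by norm_num)
  have z6 := excessIntegrand_piece_zero 6 (by norm_num) (a := 11) (b := 12) (by norm_num)
    (by norm_num) (by norm_num)
  have q6 := excessIntegrand_piece_lin 6 (by norm_num) (a := 12) (b := 13) (by norm_num)
    (by norm_num) (by norm_num)
  have z7 := excessIntegrand_piece_zero 7 (by norm_num) (a := 13) (b := 14) (by norm_num)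
    (by norm_num) (by norm_num)
  -- integrability of tails
  have t12 := q6.1.trans z7.1
  have t11 := z6.1.trans t12
  have t10 := q5.1.trans t11
  have t9 := z5.1.trans t10
  have t8 := q4.1.trans t9
  have t7 := z4.1.trans t8
  have t6 := q3.1.trans t7
  have t5 := z3.1.trans t6
  have t4 := q2.1.trans t5
  have t3 := z2.1.trans t4
  rw [← integral_add_adjacent_intervals q1.1 t3, ← integral_add_adjacent_intervals z2.1 t4,
    ← integral_add_adjacent_intervals q2.1 t5, ← integral_add_adjacent_intervals z3.1 t6,
    ← integral_add_adjacent_intervals q3.1 t7, ← integral_add_adjacent_intervals z4.1 t8,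
    ← integral_add_adjacent_intervals q4.1 t9, ← integral_add_adjacent_intervals z5.1 t10,
    ← integral_add_adjacent_intervals q5.1 t11, ← integral_add_adjacent_intervals z6.1 t12,
    ← integral_add_adjacent_intervals q6.1 z7.1,
    q1.2, z2.2, q2.2, z3.2, q3.2, z4.2, q4.2, z5.2, q5.2, z6.2, q6.2, z7.2]
  norm_num

/-- **`I_2^{14}(2) = 843/40`** (`= 1191/60 + 49/40 = 21.075`; the first integral of
Definition 51 is over the degenerate range `[1,1]`).
[cite: CalegariDimitrovTang2024, §13 eq. (tausharp A) (p. 106): `(12 + I_2^{14}(2))/98 = 27/80`] -/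
theorem integratedLcm_two_fourteen_two : integratedLcm 2 14 2 = 843 / 40 := by
  have h1 : min (2 : ℝ) 1 = 1 := by norm_num
  have h2 : max (2 : ℝ) 1 = 2 := by norm_num
  have h3 : max (1 : ℝ) 2 = 2 := by norm_num
  have h4 : max (0 : ℝ) (2 - 1) = 1 := by norm_num
  simp only [integratedLcm, h1, h2, h3, h4, intervalIntegral.integral_same, zero_add]
  have e1 : (fun t : ℝ => ∑ h ∈ Finset.Icc 1 ⌊(t - 1) / 2⌋₊, (1 : ℝ) / h) = harmIntegrand := rfl
  have e2 : (fun t : ℝ => max (t / ⌊(t + 1) / 2⌋₊ - 2) 0) = excessIntegrand := rfl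
  rw [e1, e2, integral_harmIntegrand, integral_excessIntegrand]
  norm_num

/-- The quantity minimised in `τ♯(e)` is nonnegative on `[0, m]` for the §13 data. [folklore] -/
theorem integratedLcm_nonneg {ξ : ℝ} (hξ : ξ ≤ 14) : 0 ≤ integratedLcm ξ 14 ξ := by
  unfold integratedLcm
  refine add_nonneg (add_nonneg ?_ ?_) ?_
  · exact intervalIntegral.integral_nonneg (min_le_right _ _) fun t _ => le_max_right _ _
  · refine intervalIntegral.integral_nonneg (max_le hξ (by norm_num)) fun t _ => ?_
    exact Finset.sum_nonneg fun h _ => by positivity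
  · exact intervalIntegral.integral_nonneg (max_le hξ (by norm_num)) fun t _ => le_max_right _ _

/-- **`τ♯(e) ≤ 27/80`** for the §13 integrations vector, by evaluating the minimand at `ξ = 2`:
`(2/14²)(2·6 + 1·I_2^{14}(2)) = (12 + 843/40)/98 = 27/80` (CDT eq. (tausharp A) asserts equality,
with the minimiser `ξ ∈ [2, 13/6]` read off Figure (xigraph); only this upper bound is used).
[cite: CalegariDimitrovTang2024, §13 eq. (tausharp A) (p. 106)] -/
theorem tauSharp_eA_le : tauSharp 14 eA ≤ 27 / 80 := by
  unfold tauSharp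
  rw [sup_eA, sum_eA]
  push_cast
  set F : ℝ → ℝ := fun ξ : ℝ => ξ * 6 + 1 * integratedLcm ξ 14 ξ with hF
  have hmem : F 2 ∈ F '' Icc (0 : ℝ) 14 := ⟨2, ⟨by norm_num, by norm_num⟩, rfl⟩
  have hbdd : BddBelow (F '' Icc (0 : ℝ) 14) := by
    refine ⟨0, ?_⟩
    rintro _ ⟨ξ, hξ, rfl⟩
    have := integratedLcm_nonneg hξ.2
    simp only [hF]
    nlinarith [hξ.1]
  have hle := csInf_le hbdd hmem
  have hF2 : F 2 = 2 * 6 + 843 / 40 := by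
    simp only [hF, integratedLcm_two_fourteen_two]; ring
  rw [hF2] at hle
  calc (2 : ℝ) / 14 ^ 2 * sInf (F '' Icc (0 : ℝ) 14) ≤ 2 / 14 ^ 2 * (2 * 6 + 843 / 40) := by
        gcongr
    _ = 27 / 80 := by norm_num

/-- **`τ(b;e) ≤ 191/49 + 27/80 = 16603/3920 = 4.235459…`** for the §13 data (CDT eq. (taufine)
asserts equality). [cite: CalegariDimitrovTang2024, §13 eq. (taufine) (p. 106)] -/
theorem tau_A_le : tau bA eA ≤ 16603 / 3920 := by
  unfold tau
  rw [tauFlat_bA]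
  have := tauSharp_eA_le
  norm_num at this ⊢
  linarith

/-! ### Column-shaped arrays: the closed form of `τ♭` and the `(lcm cap)` exponent

Theorem 52 (and Theorem 9) of [CalegariDimitrovTang2024] are stated for arrays `b` all of whose
columns have the shape `0 = b_{1,j} = ⋯ = b_{u_j,j} < b_{u_j+1,j} = ⋯ = b_{m,j} =: b_j`
(`u_j ∈ {0,…,m}`), and assert in the statement the closed form
`τ♭(b) = (1/m²) Σᵢ (2i−1) σᵢ = σ_m − (1/m²) Σ_j u_j² b_j ∈ [0, σ_m]`. With rows indexed by `Fin m`
the shape reads `b i j = if i < u j then 0 else c j`, and we prove the closed form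
(`tauFlat_eq_of_columnShape`), the bounds `0 ≤ τ♭(b) ≤ Σ_j c_j` (`tauFlat_nonneg_of_columnShape`,
`tauFlat_le_of_columnShape`), and the "exact computation" of §6.6.2 (eq. (lcm exp), cf. Remark 67):
with `d = mq` variables and `α = m d D/2`,
`Σ_{i ≤ m} Σ_{s ≤ d/m} Σ_h b_{i,h} ((i−1) D + s m D/d) = α τ♭(b) + (D/2) Σᵢ σᵢ`
(`sum_lcmCap_exponent_eq`; the printed asymptotic form absorbs the second term into `o(α)`). -/

/-- `Σ_{u ≤ i < m} (2i+1) = m² − u²`. [folklore] -/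
theorem sum_odd_weights_eq (m u : ℕ) (hu : u ≤ m) :
    ∑ i ∈ (Finset.range m).filter (fun i => u ≤ i), (2 * (i : ℝ) + 1) = (m : ℝ) ^ 2 - (u : ℝ) ^ 2 := by
  have hsq : ∀ n : ℕ, ∑ i ∈ Finset.range n, (2 * (i : ℝ) + 1) = (n : ℝ) ^ 2 := by
    intro n
    induction n with
    | zero => simp
    | succ n ih => rw [Finset.sum_range_succ, ih]; push_cast; ring
  have hsplit : ∑ i ∈ Finset.range m, (2 * (i : ℝ) + 1) =
      ∑ i ∈ (Finset.range m).filter (fun i => u ≤ i), (2 * (i : ℝ) + 1) +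
        ∑ i ∈ (Finset.range m).filter (fun i => ¬ u ≤ i), (2 * (i : ℝ) + 1) :=
    (Finset.sum_filter_add_sum_filter_not _ _ _).symm
  have hlow : (Finset.range m).filter (fun i => ¬ u ≤ i) = Finset.range u := by
    ext i
    simp only [Finset.mem_filter, Finset.mem_range, not_le]
    omega
  rw [hlow, hsq, hsq] at hsplit
  linarith

/-- **Closed form of `τ♭` for column-shaped arrays** (the identity in the statements of CDT
Theorems 9 and 52): if every column `j` of `b` vanishes in the rows `i < u_j` and equals `c_j` in the
rows `i ≥ u_j`, then `τ♭(b) = Σ_j c_j − (1/m²) Σ_j u_j² c_j`.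
[cite: CalegariDimitrovTang2024, §6 Theorem 52 eq. (6.3) (p. 45); §2.5 Theorem 9] -/
theorem tauFlat_eq_of_columnShape (hm : 0 < m) (b : Fin m → Fin r → ℝ) (u : Fin r → ℕ) (c : Fin r → ℝ)
    (hu : ∀ j, u j ≤ m) (hb : ∀ i j, b i j = if (i : ℕ) < u j then 0 else c j) :
    tauFlat b = ∑ j, c j - (1 / (m : ℝ) ^ 2) * ∑ j, (u j : ℝ) ^ 2 * c j := by
  have hm' : (m : ℝ) ≠ 0 := by exact_mod_cast hm.ne'
  unfold tauFlat rowSum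
  -- exchange the sums and evaluate each column
  have hcol : ∀ j : Fin r, ∑ i : Fin m, (2 * (i : ℝ) + 1) * b i j = ((m : ℝ) ^ 2 - (u j : ℝ) ^ 2) * c j := by
    intro j
    simp_rw [hb]
    rw [Fin.sum_univ_eq_sum_range (fun i => (2 * (i : ℝ) + 1) * (if i < u j then 0 else c j)) m,
      ← sum_odd_weights_eq m (u j) (hu j), Finset.sum_filter, Finset.sum_mul]
    refine Finset.sum_congr rfl fun i _ => ?_
    by_cases h : u j ≤ i
    · rw [if_pos h, if_neg (not_lt.mpr h)]
    · rw [if_neg h, if_pos (not_le.mp h), mul_zero, zero_mul]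
  have hswap : ∑ i : Fin m, (2 * (i : ℝ) + 1) * ∑ j, b i j = ∑ j, ((m : ℝ) ^ 2 - (u j : ℝ) ^ 2) * c j := by
    simp_rw [Finset.mul_sum]
    rw [Finset.sum_comm]
    exact Finset.sum_congr rfl fun j _ => hcol j
  rw [hswap, Finset.mul_sum, Finset.mul_sum, ← Finset.sum_sub_distrib]
  refine Finset.sum_congr rfl fun j _ => ?_
  field_simp

/-- `τ♭(b) ≥ 0` for a column-shaped array with non-negative entries.
[cite: CalegariDimitrovTang2024, §6 Theorem 52 ("`∈ [0, σ_m]`")] -/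
theorem tauFlat_nonneg_of_columnShape (hm : 0 < m) (b : Fin m → Fin r → ℝ) (u : Fin r → ℕ)
    (c : Fin r → ℝ) (hu : ∀ j, u j ≤ m) (hc : ∀ j, 0 ≤ c j)
    (hb : ∀ i j, b i j = if (i : ℕ) < u j then 0 else c j) : 0 ≤ tauFlat b := by
  have hm' : (0 : ℝ) < m := by exact_mod_cast hm
  rw [tauFlat_eq_of_columnShape hm b u c hu hb, Finset.mul_sum, ← Finset.sum_sub_distrib]
  refine Finset.sum_nonneg fun j _ => ?_
  have huj : (u j : ℝ) ≤ m := by exact_mod_cast hu j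
  have h1 : 1 / (m : ℝ) ^ 2 * ((u j : ℝ) ^ 2 * c j) ≤ 1 * c j := by
    rw [← mul_assoc]
    refine mul_le_mul_of_nonneg_right ?_ (hc j)
    rw [div_mul_eq_mul_div, one_mul, div_le_one (by positivity)]
    exact pow_le_pow_left₀ (Nat.cast_nonneg _) huj 2
  linarith

/-- `τ♭(b) ≤ Σ_j c_j (= σ_m)` for a column-shaped array with non-negative entries.
[cite: CalegariDimitrovTang2024, §6 Theorem 52 ("`∈ [0, σ_m]`")] -/
theorem tauFlat_le_of_columnShape (hm : 0 < m) (b : Fin m → Fin r → ℝ) (u : Fin r → ℕ)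
    (c : Fin r → ℝ) (hu : ∀ j, u j ≤ m) (hc : ∀ j, 0 ≤ c j)
    (hb : ∀ i j, b i j = if (i : ℕ) < u j then 0 else c j) : tauFlat b ≤ ∑ j, c j := by
  rw [tauFlat_eq_of_columnShape hm b u c hu hb, sub_le_self_iff]
  exact mul_nonneg (by positivity) (Finset.sum_nonneg fun j _ => by have := hc j; positivity)

/-- `Σ_{s<q} (s+1) = q(q+1)/2`. [folklore] -/
theorem sum_fin_succ_eq (q : ℕ) : ∑ s : Fin q, ((s : ℝ) + 1) = (q : ℝ) * (q + 1) / 2 := by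
  rw [Fin.sum_univ_eq_sum_range (fun s => (s : ℝ) + 1) q]
  induction q with
  | zero => simp
  | succ q ih => rw [Finset.sum_range_succ, ih]; push_cast; ring

/-- **The `(lcm cap)` exponent, exact form** (CDT §6.6.2 eq. (lcm exp), Remark 67 "an exact
computation"): with `d = mq` and `α = m d D/2`,
`Σ_{i} Σ_{s ≤ q} Σ_h b_{i,h} (i D + (s+1) m D/d) = α τ♭(b) + (D/2) Σᵢ σᵢ`
(rows `i` indexed from `0`, so the printed `(i−1)D` is `iD`).
[cite: CalegariDimitrovTang2024, §6.6.2 eq. (lcm exp) (p. 56)] -/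
theorem sum_lcmCap_exponent_eq (hm : 0 < m) {q : ℕ} (hq : 0 < q) (b : Fin m → Fin r → ℝ) (D : ℝ) :
    ∑ i : Fin m, ∑ s : Fin q, ∑ h : Fin r, b i h * ((i : ℝ) * D + ((s : ℝ) + 1) * m * D / (m * q)) =
      ((m : ℝ) * (m * q) * D / 2) * tauFlat b + D / 2 * ∑ i, rowSum b i := by
  have hm' : (m : ℝ) ≠ 0 := by exact_mod_cast hm.ne'
  have hq' : (q : ℝ) ≠ 0 := by exact_mod_cast hq.ne'
  -- inner sums over `s`
  have hinner : ∀ i : Fin m, ∑ s : Fin q, ∑ h : Fin r, b i h * ((i : ℝ) * D + ((s : ℝ) + 1) * m * D / (m * q)) =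
      rowSum b i * ((q : ℝ) * i * D + D * (q + 1) / 2) := by
    intro i
    rw [Finset.sum_comm]
    unfold rowSum
    rw [Finset.sum_mul]
    refine Finset.sum_congr rfl fun h _ => ?_
    rw [← Finset.mul_sum]
    congr 1
    rw [Finset.sum_add_distrib, Finset.sum_const, Finset.card_univ, Fintype.card_fin, nsmul_eq_mul]
    have : ∑ s : Fin q, ((s : ℝ) + 1) * m * D / (m * q) = (D / q) * ∑ s : Fin q, ((s : ℝ) + 1) := by
      rw [Finset.mul_sum]
      refine Finset.sum_congr rfl fun s _ => ?_
      field_simp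
    rw [this, sum_fin_succ_eq]
    field_simp
  simp_rw [hinner]
  unfold tauFlat
  rw [Finset.mul_sum, Finset.mul_sum, Finset.mul_sum, ← Finset.sum_add_distrib]
  refine Finset.sum_congr rfl fun i _ => ?_
  field_simp
  ring

end HolonomyBound

end Literature.NumberTheory.Transcendental
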